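import Literature.AnabelianGeometry.SemiGraphs.TemperedPiFibreFaithful
import Literature.AnabelianGeometry.SemiGraphs.CharacteristicOpenCore
import HarnessLib

/-!
# The stabiliser of a tower point contains the characteristic open core of the fibre cardinality ([SemiAnbd] Prop 3.6 / Thm 3.7 (iii))

Mochizuki, *Semi-graphs of anabelioids*, Publ. RIMS **42** (2006) [MochizukiSemiAnbd2006], §3 p. 38
("`𝒢_{∞,i} → 𝒢_i` … the 'combinatorial universal covering' of `𝒢_i` [i.e., the covering of `𝒢_i`
determined by the universal graph-covering of the underlying semi-graph `𝔾_i`]") and the proof of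
Thm 3.7 (iii) p. 41 ("this action factors through a finite quotient"). [cite: MochizukiSemiAnbd2006, Prop 3.6 p.38]

PROOF-ONLY file (abc-iut cell, FRONTIER programme REFUTE-F1732, brick R6c, the generic half of (c2)
«consecutive edge generators of a ray coincide at a fixed level»; seat abc-iut-L3-t11 gen 3; no definitions,
no named facts).  For a Galois tower `D : GaloisLevelData 𝒢` (abc-iut-L3-t9) and a compatible point sequence
`P` over `w` (abc-iut-L3-t6), the UNIFORM lower bound on the kernel of the level-`n` decomposition map
`h ↦ σ_n^h` (`PointSeq.gal`): since `𝒢_{∞,S n} → 𝒢_{S n}` is combinatorial, `Π_w` acts on a point of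
`(𝒢_{∞,S n})_w` through its image point of the FINITE fibre `(S n)_w`, so

* `PointSeq.stabilizer_proj_le_stabilizer` — `Stab_{Π_w}(image of P.pt n in (S n)_w) ≤ Stab_{Π_w}(P.pt n)`
  (t6's `cover_ρ_eq_self_of_proj`);
* `CovObj.index_stabilizerSubgroup_le_card` — for a FINITE object `X` of `B^temp(Π)`, the stabiliser of
  a point has finite index `≤ Nat.card X` (the orbit map `Π / Stab(x) ↪ X`);
* `PointSeq.charOpenCore_le_stabilizer` — hence `charOpenCore Π_w (Nat.card (S n)_w) ≤ Stab(P.pt n)`: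
  EVERY element of `Π_w` lying in all open subgroups of index `≤ #(S n)_w` acts trivially on `P.pt n`,
  a bound depending on the level `n` and the fibre cardinality ONLY (for connected finite levels the fibre
  cardinality is the same over every vertex — abc-iut-L5-t16's `nodeCard_eq_of_reachable` — hence
  uniform along a ray of vertices);
* `PointSeq.gal_eq_one_of_mem_charOpenCore`, `PointSeq.gal_eq_gal_of_mem_charOpenCore`,
  `PointSeq.proj_decompHom_eq_of_mem_charOpenCore` — the level-`n` components of `ψ(h)`, `ψ(h')` agree
  once `h⁻¹ h' ∈ charOpenCore Π_w (#(S n)_w)`: with abc-iut-L3-t11's apartment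
  (`TemperedPiRayApartment.lean`: `z_{k+1} = ψ_{k+1}((βm (k+1))_* x)`, `z_k = ψ_{k+1}((βp k)_* x)`) this is
  abc-iut-L3-d4's (c2) «`ρ_n (z_{k+1}) = ρ_n (z_k)` for `n_{k+1} ≥ N_n`» at `𝒢_θ`, where
  `((a b^{p^{n_{k+1}}}))⁻¹ a = b^{-p^{n_{k+1}}} ∈ charOpenCore` for `p^{n_{k+1}} ≥ #(S n)_w` (R1b).

Consumer: the R6 assembly (abc-iut-L3-d4) for the desk countermodel `𝒢_θ` of abc-iut-L3-d1 — towards a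
kernel erratum for the ∀-countable reading of [SemiAnbd] Thm 3.7 (iii) ([IUTchI] Rmk 2.5.3); print proves
finite `𝔾` (kernel: `compactInVerticialAt_of_finiteGraph`).  Nothing here bears on [IUTchIII] Cor. 3.12;
typed ≠ proved.
-/

namespace Literature.AnabelianGeometry.SemiGraphs

namespace ProfiniteSemiGraph

open CategoryTheory Topology
open Literature.AlgebraicGeometry.Frobenioids.QuasiTemperoid (stabilizerSubgroup
  mem_stabilizerSubgroup_iff isOpen_stabilizerSubgroup)
open Literature.AlgebraicGeometry.Frobenioids.QuasiTemperoid.BTempConnected (ρ_one_apply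
  ρ_mul_apply ρ_inv_apply)

universe u

/-! ### Finite objects of `B^temp(Π)`: stabilisers have index at most the cardinality -/

section FiniteObjects

variable {Γ : Type u} [Group Γ] [TopologicalSpace Γ]

/-- **The orbit map `Π / Stab(x) → X` is injective**, for a point `x` of an object `X` of `B^temp(Π)`.
[cite: MochizukiSemiAnbd2006, Prop 3.6 p.38] -/
theorem CovObj.quotient_stabilizerSubgroup_injective (X : BTemp Γ) (x : X.obj.V) :
    Function.Injective (Quotient.lift (s := QuotientGroup.leftRel (stabilizerSubgroup X x))
      (fun g : Γ => X.obj.ρ g x) (fun a b hab => by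
        have hab' := QuotientGroup.leftRel_apply.mp hab
        rw [mem_stabilizerSubgroup_iff] at hab'
        have h := congrArg (X.obj.ρ a) hab'
        rw [← ρ_mul_apply, mul_inv_cancel_left] at h
        exact h.symm) :
      Γ ⧸ stabilizerSubgroup X x → X.obj.V) := by
  intro p q hpq
  induction p using Quotient.inductionOn with
  | h a =>
    induction q using Quotient.inductionOn with
    | h b =>
      apply Quotient.sound
      apply QuotientGroup.leftRel_apply.mpr
      rw [mem_stabilizerSubgroup_iff]
      change X.obj.ρ a x = X.obj.ρ b x at hpq
      have h := congrArg (X.obj.ρ a⁻¹) hpq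
      rw [← ρ_mul_apply, inv_mul_cancel, ρ_one_apply, ← ρ_mul_apply] at h
      exact h.symm

/-- **For a FINITE object `X` of `B^temp(Π)`, the stabiliser of a point has finite index at most
`Nat.card X`.** [cite: MochizukiSemiAnbd2006, Prop 3.6 p.38] -/
theorem CovObj.index_stabilizerSubgroup_le_card (X : BTemp Γ) [Finite X.obj.V] (x : X.obj.V) :
    0 < (stabilizerSubgroup X x).index ∧ (stabilizerSubgroup X x).index ≤ Nat.card X.obj.V := by
  have hinj := CovObj.quotient_stabilizerSubgroup_injective X x
  haveI : Finite (Γ ⧸ stabilizerSubgroup X x) := Finite.of_injective _ hinj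
  refine ⟨?_, ?_⟩
  · change 0 < Nat.card (Γ ⧸ stabilizerSubgroup X x)
    exact Nat.card_pos
  · change Nat.card (Γ ⧸ stabilizerSubgroup X x) ≤ Nat.card X.obj.V
    exact Nat.card_le_card_of_injective _ hinj

/-- Hence the stabiliser of a point of a finite object is one of the open subgroups of index
`≤ Nat.card X`, and contains the characteristic open core of that level.
[cite: MochizukiSemiAnbd2006, Prop 3.6 p.38] -/
theorem CovObj.charOpenCore_le_stabilizerSubgroup (X : BTemp Γ) [Finite X.obj.V] (x : X.obj.V) :
    charOpenCore Γ (Nat.card X.obj.V) ≤ stabilizerSubgroup X x :=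
  charOpenCore_le ⟨isOpen_stabilizerSubgroup X x, CovObj.index_stabilizerSubgroup_le_card X x⟩

end FiniteObjects

/-! ### Points of the tower: the action is through the finite level -/

namespace GaloisLevelData

variable {𝒢 : ProfiniteSemiGraph.{u}} (D : GaloisLevelData 𝒢) (h𝒢 : 𝒢.IsCountable)

/-- The stabiliser in `Π_w` of the image in `(S n)_w` of a point of `(𝒢_{∞,S n})_w` (under the projection
`𝒢_{∞,S n} → 𝒢_{S n}`) is contained in the stabiliser of the point: `Π_w` acts on `(𝒢_{∞,S n})_w` through
`(S n)_w` (orbit and path class of a point are untouched). [cite: MochizukiSemiAnbd2006, Prop 3.6 p.38] -/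
theorem stabilizer_proj_le_stabilizer (n : ℕ) {w : 𝒢.graph.Vertex} (t : ((D.cover h𝒢 n).SV w).obj.V) :
    stabilizerSubgroup ((D.S n).SV w)
        ((((D.S n).univCoverOverProj (Sum.inl (D.W n)) h𝒢).fV w).hom.hom t) ≤
      stabilizerSubgroup ((D.cover h𝒢 n).SV w) t :=
  fun h hh => D.cover_ρ_eq_self_of_proj h𝒢 n h t hh

/-- **The characteristic open core of `Π_w` of level `#(S n)_w` fixes every point of `(𝒢_{∞,S n})_w`**
(finite level `S n`). [cite: MochizukiSemiAnbd2006, Prop 3.6 p.38] -/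
theorem charOpenCore_le_stabilizer (n : ℕ) {w : 𝒢.graph.Vertex} [Finite ((D.S n).SV w).obj.V]
    (t : ((D.cover h𝒢 n).SV w).obj.V) :
    charOpenCore (𝒢.Gv w) (Nat.card ((D.S n).SV w).obj.V) ≤ stabilizerSubgroup ((D.cover h𝒢 n).SV w) t :=
  (CovObj.charOpenCore_le_stabilizerSubgroup ((D.S n).SV w) _).trans (D.stabilizer_proj_le_stabilizer h𝒢 n t)

/-- Pointwise form: an element of the characteristic open core of level `#(S n)_w` fixes the point.
[cite: MochizukiSemiAnbd2006, Prop 3.6 p.38] -/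
theorem cover_ρ_eq_self_of_mem_charOpenCore (n : ℕ) {w : 𝒢.graph.Vertex} [Finite ((D.S n).SV w).obj.V]
    (t : ((D.cover h𝒢 n).SV w).obj.V) (h : 𝒢.Gv w)
    (hh : h ∈ charOpenCore (𝒢.Gv w) (Nat.card ((D.S n).SV w).obj.V)) :
    ((D.cover h𝒢 n).SV w).obj.ρ h t = t :=
  mem_stabilizerSubgroup_iff.mp (D.charOpenCore_le_stabilizer h𝒢 n t hh)

namespace PointSeq

variable {D h𝒢} {w : 𝒢.graph.Vertex} (P : D.PointSeq h𝒢 w)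

/-- **The level-`n` decomposition map kills the characteristic open core of level `#(S n)_w`**:
`σ_n^h = 1` for `h ∈ charOpenCore Π_w (#(S n)_w)`. [cite: MochizukiSemiAnbd2006, Thm 3.7(iii) p.41] -/
theorem gal_eq_one_of_mem_charOpenCore (n : ℕ) [Finite ((D.S n).SV w).obj.V] (h : 𝒢.Gv w)
    (hh : h ∈ charOpenCore (𝒢.Gv w) (Nat.card ((D.S n).SV w).obj.V)) : P.gal n h = 1 :=
  (P.gal_eq_one_iff n h).mpr (D.cover_ρ_eq_self_of_mem_charOpenCore h𝒢 n (P.pt n) h hh)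

/-- **Two elements of `Π_w` congruent modulo the characteristic open core of level `#(S n)_w` have the
same level-`n` component**: `σ_n^h = σ_n^{h'}` if `h⁻¹ h' ∈ charOpenCore Π_w (#(S n)_w)`.
[cite: MochizukiSemiAnbd2006, Thm 3.7(iii) p.41] -/
theorem gal_eq_gal_of_mem_charOpenCore (n : ℕ) [Finite ((D.S n).SV w).obj.V] (h h' : 𝒢.Gv w)
    (hh : h⁻¹ * h' ∈ charOpenCore (𝒢.Gv w) (Nat.card ((D.S n).SV w).obj.V)) : P.gal n h = P.gal n h' := by
  have key : ((D.proj h𝒢 n).comp P.decompHom) (h⁻¹ * h') = 1 :=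
    P.gal_eq_one_of_mem_charOpenCore n (h⁻¹ * h') hh
  rw [map_mul, map_inv, inv_mul_eq_one] at key
  exact key

/-- In `π₁^temp`: the level-`n` components of `ψ(h)` and `ψ(h')` (`ψ = P.decompHom`) agree once
`h⁻¹ h' ∈ charOpenCore Π_w (#(S n)_w)` — abc-iut-L3-d4's (c2) «coincidence at a level» in generic form
(at the apartment of a ray: `z_k = ψ_{k+1}((βp k)_* x)`, `z_{k+1} = ψ_{k+1}((βm (k+1))_* x')`,
`TemperedPiRayApartment.decompHom_brHom_succ_eq`). [cite: MochizukiSemiAnbd2006, Thm 3.7(iii) p.41] -/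
theorem proj_decompHom_eq_of_mem_charOpenCore (n : ℕ) [Finite ((D.S n).SV w).obj.V] (h h' : 𝒢.Gv w)
    (hh : h⁻¹ * h' ∈ charOpenCore (𝒢.Gv w) (Nat.card ((D.S n).SV w).obj.V)) :
    D.proj h𝒢 n (P.decompHom h) = D.proj h𝒢 n (P.decompHom h') :=
  P.gal_eq_gal_of_mem_charOpenCore n h h' hh

/-- The same for the tree action at level `n`. [cite: MochizukiSemiAnbd2006, Thm 3.7(iii) p.41] -/
theorem treeAct_decompHom_eq_of_mem_charOpenCore (n : ℕ) [Finite ((D.S n).SV w).obj.V] (h h' : 𝒢.Gv w)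
    (hh : h⁻¹ * h' ∈ charOpenCore (𝒢.Gv w) (Nat.card ((D.S n).SV w).obj.V)) :
    D.treeAct h𝒢 n (P.decompHom h) = D.treeAct h𝒢 n (P.decompHom h') := by
  rw [D.treeAct_apply, D.treeAct_apply, P.proj_decompHom_eq_of_mem_charOpenCore n h h' hh]

end PointSeq

end GaloisLevelData

end ProfiniteSemiGraph

end Literature.AnabelianGeometry.SemiGraphs
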